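import Mathlib.Analysis.Real.Sqrt
import Mathlib.NumberTheory.LegendreSymbol.QuadraticChar.Basic
import Mathlib.NumberTheory.LegendreSymbol.Basic
import Mathlib.Tactic.Abel
import Literature.Combinatorics.SimpleGraph.PaleySos
import HarnessLib

/-!
# Kunisky–Yu 2022: the elementary layer — Seidel matrix of the Paley graph, `SOS₂(G_p) ≥ √p`

Sibling proofs file of `PaleySos.lean` (the named fact `kuniskyYu2022_theorem_1_2`, KY Theorem 1.2:
`SOS₄(G_p) ≥ c p^{1/3}`). Everything here is PROVED and nothing here discharges the fact (see
"Not here"). We formalise the character-sum-free layer of the printed proof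
[KuniskyYu2022, §2.2.2, §3.2, §4.1], with the Seidel matrix `S` (KY §2.1: `+1` on edges, `−1` on
non-edges, `0` diagonal) passed as an explicit matrix `S` with its defining hypothesis `hS`:

* `sqrt_card_le_lasserreStableBound_compl_one` / `…_one` — for a graph on `q` vertices whose
  Seidel matrix has zero row sums and `S² = qI − J` (a conference graph), `√q ≤ las⁽¹⁾(Ḡ)` and
  `√q ≤ las⁽¹⁾(G)`, by the explicit level-`1` Lasserre point `y_∅ = 1`, `y_v = 1/√q`,
  `y_{uv} = 2/(√q(1+√q))·[u ∼ v]`: its moment matrix is `w wᵀ + E (κX) Eᵀ`, `X = S² + √q S`, and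
  `X² = 2qX` (from `S³ = qS`, `SJ = 0`) makes `X = XXᵀ/(2q) ⪰ 0` — the eigenvalue-free form of the
  computation behind KY (17)–(18) (`SOS₂(G_q) = ϑ(Ḡ_q) = √q`, after Lovász 1979) and behind KY
  Proposition 3.6 (`H^{1,1} = α₁I + α₂A − α₁²J ≻ 0`).
* The Paley graph `paleyGraph p` (`p` prime, `p ≡ 1 (mod 4)`) through the quadratic character `χ`
  of `𝔽_p = ZMod p`: adjacency `x ∼ y ↔ x ≠ y ∧ χ(x − y) = 1` (KY Proposition 3.19),
  `S_{xy} = χ(x − y)` (KY §3.4), zero row sums (KY Proposition 4.5) and `S² = pI − J`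
  (KY Proposition 4.6, (74)) from the Jacobsthal sum `Σ_t χ(t(t + c)) = −1`, `c ≠ 0`.
* `sqrt_le_lasserreStableBound_compl_paleyGraph_one`, `sqrt_le_lasserreStableBound_paleyGraph_one`:
  `√p ≤ las⁽¹⁾(Ḡ_p)` and `√p ≤ las⁽¹⁾(G_p)` — the level-`1` rung (KY (18), lower half).

## Not here, and why (state of the discharge of `kuniskyYu2022_theorem_1_2`)

The level-`2` bound needs KY Theorem 3.35, `‖T^{4,4,1}‖ = O(p^{5/4})` for the 4-cycle graph
matrix `T^{4,4,1}_{ab,cd} = χ((a−c)(a−d)(b−c)(b−d))`, whose printed proof rests on sums of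
products of four Kloosterman sums [FKM15, Cor. 3.2] and on [Liu02] (Deligne–Katz level input),
neither in Mathlib nor in this tree; every other norm bound of KY §4 follows from `S² = pI − J`.
Only a one-sided bound `λ_max(P₂ T^{4,4,1} P₂) ≤ C p^{4/3}` (any constant `C`) is needed.

## A remark on the printed parameters of KY Theorem 3.1 (observation of this formalisation)

With `α₂ = kα₁²`, `α₃ = mα₁³` and the test vector `(0; t·u; (u_b + u_c)·[b ∼ c])`, `u ⟂ 𝟙` an
eigenvector of `A`, the `2 × 2` compression of the FK pseudomoment matrix has determinant
`≈ α₁³p·(k/2 + (m/8 − k²/4)α₁p)`, negative for large `p` unless `m ≥ 2k²`; the printed choice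
`(k, m) = (4, 8)` therefore does not give `M ⪰ 0` (the slip is the "`O(pα₁⁴)`" in KY (61): the
`T^{3,0,1}`-part of `H^{2,1}H^{1,2}` on `V₁` is `≈ 16pα₁³`). The argument goes through with e.g.
`α₂ = 4α₁²`, `α₃ = 40α₁³`, `α₄ = 1024α₁⁴`; Theorem 1.2 is unaffected (checked numerically for
`p = 1009, 4001, 10009`; details in the unit notes).

## References

* [KuniskyYu2022] D. Kunisky, X. Yu, arXiv:2211.02713: §2.1, §2.2.2 (17)–(18), Prop. 3.6,
  Remark 3.18, Prop. 3.19, §3.4, Props. 4.5–4.6, (74)–(75).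
* [Lovasz1979] L. Lovász, On the Shannon capacity of a graph, Thm. 8 — context only.
-/

noncomputable section

namespace Literature.Combinatorics.SimpleGraph

open Matrix Finset

/-! ### Conference graphs: `las⁽¹⁾ ≥ √q` -/

section Seidel

variable {V : Type*} [Fintype V] [DecidableEq V] (G : _root_.SimpleGraph V) [DecidableRel G.Adj]

/-- **Conference graphs have `SOS₂ ≥ √q`** (the computation behind Kunisky–Yu (17)–(18) and
Proposition 3.6, without eigenvalues). If the Seidel matrix `S` of a graph `G` on `q` vertices has
zero row sums and satisfies `S² = qI − J`, then `√q ≤ las⁽¹⁾(Ḡ)` (`S` is passed as a matrix with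
its defining hypothesis `hS`, KY §2.1: `+1` on edges, `−1` off edges, `0` diagonal): the moment
vector
`y_∅ = 1`, `y_v = 1/√q`, `y_{uv} = 2/(√q(1+√q))·[u ∼_G v]` is feasible for the stable-set program of
`Ḡ` (it vanishes on the edges of `Ḡ`), with value `√q`; its moment matrix is
`w wᵀ + E (κ X) Eᵀ`, `X = S² + √q S`, `κ = 1/(q(1+√q))`, and `X² = 2qX` (from `S³ = qS`,
`SJ = 0`) gives `X = X Xᵀ/(2q) ⪰ 0`. [cite: KuniskyYu2022, §2.2.2 (17)–(18)] -/
theorem sqrt_card_le_lasserreStableBound_compl_one (S : Matrix V V ℝ)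
    (hS : ∀ u v, S u v = if u = v then 0 else if G.Adj u v then 1 else -1)
    (hrow : ∀ u, ∑ v, S u v = 0)
    (hsq : S * S = (Fintype.card V : ℝ) • (1 : Matrix V V ℝ) - of fun _ _ => 1) :
    Real.sqrt (Fintype.card V) ≤ lasserreStableBound Gᶜ 1 := by
  classical
  rcases isEmpty_or_nonempty V with hV | hV
  · have h0 : Fintype.card V = 0 := Fintype.card_eq_zero
    rw [h0, Nat.cast_zero, Real.sqrt_zero]
    exact lasserreStableBound_nonneg Gᶜ 1 le_rfl
  -- notation
  set q : ℝ := (Fintype.card V : ℝ) with hq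
  set r : ℝ := Real.sqrt q with hr
  set J : Matrix V V ℝ := of fun _ _ => (1 : ℝ) with hJ
  have hqpos : 0 < q := by
    rw [hq]; exact_mod_cast Fintype.card_pos
  have hrpos : 0 < r := Real.sqrt_pos.2 hqpos
  have hrr : r * r = q := Real.mul_self_sqrt hqpos.le
  -- matrix identities
  have hSt : Sᵀ = S := by
    ext u v
    rw [transpose_apply, hS, hS]
    by_cases h : u = v
    · subst h; simp
    · have h' : v ≠ u := Ne.symm h
      by_cases hadj : G.Adj u v
      · simp [h, h', hadj, hadj.symm]
      · have hadj' : ¬ G.Adj v u := fun x => hadj x.symm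
        simp [h, h', hadj, hadj']
  have hSJ : S * J = 0 := by
    ext u v
    simp [hJ, mul_apply, hrow u]
  have hJS : J * S = 0 := by
    have h := congrArg transpose hSJ
    rw [transpose_mul, hSt, transpose_zero] at h
    have hJt : Jᵀ = J := by ext u v; simp [hJ]
    rwa [hJt] at h
  have hS3 : S * S * S = q • S := by
    rw [hsq, sub_mul, smul_mul, one_mul, hJS, sub_zero]
  have hS3' : S * (S * S) = q • S := by rw [← mul_assoc, hS3]
  have hS4 : S * S * (S * S) = q • (S * S) := by rw [← mul_assoc, hS3, smul_mul]
  set X : Matrix V V ℝ := S * S + r • S with hX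
  have hXt : Xᵀ = X := by
    rw [hX, transpose_add, transpose_mul, transpose_smul, hSt]
  have hXX : X * X = (2 * q) • X := by
    have h1 : X * X =
        S * S * (S * S) + r • (S * S * S) + r • (S * (S * S)) + (r * r) • (S * S) := by
      simp only [hX, add_mul, mul_add, Matrix.mul_smul, Matrix.smul_mul, smul_smul]
      abel
    rw [h1, hS4, hS3, hS3', hrr, hX, smul_add, smul_smul, smul_smul]
    ext u v
    simp only [Matrix.add_apply, Matrix.smul_apply, smul_eq_mul]
    ring
  have hXpsd : X.PosSemidef := by
    have h := posSemidef_self_mul_conjTranspose X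
    rw [conjTranspose_eq_transpose_of_trivial, hXt, hXX] at h
    have h2 := h.smul (a := (2 * q)⁻¹) (by positivity)
    rwa [smul_smul, inv_mul_cancel₀ (by positivity), one_smul] at h2
  -- constants
  set a : ℝ := r⁻¹ with ha
  set b : ℝ := 2 / (r * (1 + r)) with hb
  set κ : ℝ := 1 / (r * r * (1 + r)) with hκ
  have hκnn : 0 ≤ κ := by positivity
  have id_diag : a = a * a + κ * (q - 1 + r * 0) := by
    rw [ha, hκ, ← hrr]; field_simp; ring
  have id_adj : b = a * a + κ * (0 - 1 + r * 1) := by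
    rw [ha, hb, hκ]; field_simp; ring
  have id_nadj : (0 : ℝ) = a * a + κ * (0 - 1 + r * (-1)) := by
    rw [ha, hκ]; field_simp; ring
  -- the level-1 moment vector
  set y : Finset V → ℝ := fun T =>
    if T.card = 0 then 1 else if T.card = 1 then a
      else if T.card = 2 ∧ G.IsClique (T : Set V) then b else 0 with hy
  have y_empty : y ∅ = 1 := by simp [y]
  have y_single : ∀ v, y {v} = a := fun v => by simp [y]
  have y_pair : ∀ {u v}, u ≠ v → y {u, v} = if G.Adj u v then b else 0 := by
    intro u v huv
    have hc : ({u, v} : Finset V).card = 2 := card_pair huv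
    have hcl : G.IsClique (({u, v} : Finset V) : Set V) ↔ G.Adj u v := by
      rw [coe_pair, SimpleGraph.isClique_pair]
      exact ⟨fun h => h huv, fun h _ => h⟩
    simp only [y, hc, hcl]
    simp
  -- entries of X
  have hX_apply : ∀ u v, X u v = (if u = v then q else 0) - 1 + r * S u v := by
    intro u v
    have h := congrFun (congrFun hsq u) v
    simp only [Matrix.sub_apply, Matrix.smul_apply, one_apply, smul_eq_mul, mul_ite, mul_one,
      mul_zero] at h
    simp only [hX, Matrix.add_apply, Matrix.smul_apply, smul_eq_mul, h, hJ, of_apply]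
  -- feasibility
  have hfeas : IsLasserreFeasible Gᶜ 1 y := by
    refine ⟨y_empty, ?_, ?_⟩
    · intro u v huv
      rw [SimpleGraph.compl_adj] at huv
      rw [y_pair huv.1, if_neg huv.2]
    · -- `M₁(y) = w wᵀ + E (κ X) Eᵀ`
      let T := {A : Finset V // A.card ≤ 1}
      let w : T → ℝ := fun I => y I.1
      let E : Matrix T V ℝ := of fun I v => if v ∈ I.1 then 1 else 0
      have hE : ∀ (N : Matrix V V ℝ) (I K : T),
          (E * N * Eᴴ) I K = ∑ v ∈ I.1, ∑ v' ∈ K.1, N v v' := by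
        intro N I K
        have hin : ∀ v', (∑ v, E I v * N v v') = ∑ v ∈ I.1, N v v' := by
          intro v'
          simp only [E, of_apply, ite_mul, one_mul, zero_mul]
          rw [Finset.sum_ite_mem, univ_inter]
        simp only [mul_apply, conjTranspose_apply, star_trivial, hin]
        simp only [E, of_apply, mul_ite, mul_one, mul_zero]
        rw [Finset.sum_ite_mem, univ_inter, Finset.sum_comm]
      have hcases : ∀ I : T, I.1 = ∅ ∨ ∃ u, I.1 = {u} := by
        intro I
        by_cases h0 : I.1.card = 0
        · exact Or.inl (card_eq_zero.1 h0)
        · have h1 : I.1.card = 1 := by have := I.2; omega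
          exact Or.inr (card_eq_one.1 h1)
      have hM : momentMatrix 1 y = vecMulVec w (star w) + E * (κ • X) * Eᴴ := by
        ext I K
        rw [momentMatrix_apply, Matrix.add_apply, vecMulVec_apply, Pi.star_apply, star_trivial, hE]
        rcases hcases I with hI | ⟨u, hu⟩ <;> rcases hcases K with hK | ⟨v, hv⟩
        · simp [w, hI, hK, y_empty]
        · simp [w, hI, hv, y_empty, y_single]
        · simp [w, hu, hK, y_empty, y_single]
        · simp only [w, hu, hv, y_single, sum_singleton, Matrix.smul_apply, smul_eq_mul, hX_apply]
          by_cases huv : u = v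
          · subst huv
            rw [union_self, y_single, if_pos rfl, hS, if_pos rfl]
            exact id_diag
          · rw [← insert_eq, y_pair huv, if_neg huv, hS, if_neg huv]
            by_cases hadj : G.Adj u v
            · rw [if_pos hadj, if_pos hadj]; exact id_adj
            · rw [if_neg hadj, if_neg hadj]; exact id_nadj
      rw [hM]
      exact (posSemidef_vecMulVec_self_star w).add
        ((hXpsd.smul hκnn).mul_mul_conjTranspose_same E)
  -- value
  have hval : ∑ v, y {v} = r := by
    simp only [y_single, sum_const, card_univ, nsmul_eq_mul, ha]
    rw [← hq, ← hrr, mul_inv_cancel_right₀ hrpos.ne']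
  rw [← hval]
  exact hfeas.sum_singleton_le_lasserreStableBound le_rfl

/-- The same bound for `G` itself: under `S𝟙 = 0`, `S² = qI − J` also `√q ≤ las⁽¹⁾(G)`
(apply the previous result to `Ḡ`, whose Seidel matrix `−S` satisfies the same identities; for a
self-complementary vertex-transitive graph this is Lovász's `ϑ(G)ϑ(Ḡ) = q`).
[cite: KuniskyYu2022, §2.2.2 (17)–(18)] -/
theorem sqrt_card_le_lasserreStableBound_one (S : Matrix V V ℝ)
    (hS : ∀ u v, S u v = if u = v then 0 else if G.Adj u v then 1 else -1)
    (hrow : ∀ u, ∑ v, S u v = 0)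
    (hsq : S * S = (Fintype.card V : ℝ) • (1 : Matrix V V ℝ) - of fun _ _ => 1) :
    Real.sqrt (Fintype.card V) ≤ lasserreStableBound G 1 := by
  have hS' : ∀ u v, (-S) u v = if u = v then 0 else if Gᶜ.Adj u v then 1 else -1 := by
    intro u v
    rw [Matrix.neg_apply, hS]
    by_cases h : u = v
    · simp [h]
    · by_cases hadj : G.Adj u v <;> simp [h, hadj, SimpleGraph.compl_adj]
  have h := sqrt_card_le_lasserreStableBound_compl_one Gᶜ (-S) hS'
    (fun u => by simp only [Matrix.neg_apply, sum_neg_distrib, hrow u, neg_zero])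
    (by rw [neg_mul_neg, hsq])
  rwa [compl_compl] at h

end Seidel

/-! ### The Paley graph through the quadratic character -/

section Paley

variable (n : ℕ) [hp : Fact (n + 1).Prime]

variable {n} in
/-- `−1` is a square in `𝔽_p` for `p ≡ 1 (mod 4)` (Kunisky–Yu, after Definition 2.3: "The condition
`q ≡ 1 (mod 4)` ensures that `−1` is a square in `𝔽_q`"). [cite: KuniskyYu2022, Definition 2.3] -/
theorem isSquare_neg_one_zmod (h4 : (n + 1) % 4 = 1) : IsSquare (-1 : ZMod (n + 1)) :=
  ZMod.exists_sq_eq_neg_one_iff.2 (by omega)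

variable {n} in
/-- The characteristic of `𝔽_p`, `p ≡ 1 (mod 4)`, is not `2`. [folklore] -/
theorem ringChar_zmod_ne_two (h4 : (n + 1) % 4 = 1) : ringChar (ZMod (n + 1)) ≠ 2 := by
  rw [ZMod.ringChar_zmod_n]; omega

variable {n} in
/-- `χ(−x) = χ(x)` for `p ≡ 1 (mod 4)` (Kunisky–Yu, Remark 3.18).
[cite: KuniskyYu2022, Remark 3.18] -/
theorem quadraticChar_neg_eq (h4 : (n + 1) % 4 = 1) (x : ZMod (n + 1)) :
    quadraticChar (ZMod (n + 1)) (-x) = quadraticChar (ZMod (n + 1)) x := by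
  have h1 : quadraticChar (ZMod (n + 1)) (-1) = 1 :=
    (quadraticChar_one_iff_isSquare (neg_ne_zero.2 one_ne_zero)).2 (isSquare_neg_one_zmod h4)
  rw [neg_eq_neg_one_mul, map_mul, h1, one_mul]

/-- **Adjacency in the Paley graph** through squares of `𝔽_p` (`p ≡ 1 (mod 4)`): `x ∼ y` iff
`x ≠ y` and `x − y` is a square (the symmetrised `fromRel` relation collapses because `−1` is a
square). [cite: KuniskyYu2022, Definition 2.3] -/
theorem paleyGraph_adj_iff_isSquare (h4 : (n + 1) % 4 = 1) (x y : ZMod (n + 1)) :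
    (paleyGraph (n + 1)).Adj x y ↔ x ≠ y ∧ IsSquare (x - y) := by
  have h0 := paleyGraph_adj (n + 1) x y
  rw [h0]
  change x ≠ y ∧ (IsSquare (x - y) ∨ IsSquare (y - x)) ↔ _
  refine and_congr_right fun _ => ⟨?_, fun h => Or.inl h⟩
  rintro (h | h)
  · exact h
  · have h' := h.mul (isSquare_neg_one_zmod h4)
    rwa [show (y - x) * (-1 : ZMod (n + 1)) = x - y by ring] at h'

/-- **Kunisky–Yu, Proposition 3.19** (its `1 × 1` case): for distinct `x, y`, `x ∼ y` in `G_p` iff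
`χ(x − y) = 1`, i.e. `½(1 + χ(x − y))` is the edge indicator.
[cite: KuniskyYu2022, Proposition 3.19] -/
theorem paleyGraph_adj_iff_quadraticChar (h4 : (n + 1) % 4 = 1) (x y : ZMod (n + 1)) :
    (paleyGraph (n + 1)).Adj x y ↔ x ≠ y ∧ quadraticChar (ZMod (n + 1)) (x - y) = 1 := by
  rw [paleyGraph_adj_iff_isSquare n h4]
  refine and_congr_right fun hne => ?_
  rw [quadraticChar_one_iff_isSquare (sub_ne_zero.2 hne)]

/-- **The Seidel matrix of the Paley graph is `S_{xy} = χ(x − y)`** (Kunisky–Yu §3.4: "let us write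
`S` for the Seidel adjacency matrix of `G_p`, so that `S_{a,b} := χ(a − b)`").
[cite: KuniskyYu2022, §3.4] -/
theorem paley_seidel_apply [DecidableRel (paleyGraph (n + 1)).Adj] (h4 : (n + 1) % 4 = 1)
    {S : Matrix (Fin (n + 1)) (Fin (n + 1)) ℝ}
    (hS : ∀ u v, S u v = if u = v then 0 else if (paleyGraph (n + 1)).Adj u v then 1 else -1)
    (x y : ZMod (n + 1)) : S x y = (quadraticChar (ZMod (n + 1)) (x - y) : ℝ) := by
  rw [hS]
  split_ifs with hxy hadj
  · have h0 : x - y = 0 := sub_eq_zero.2 hxy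
    rw [h0, MulChar.map_zero, Int.cast_zero]
  · rw [((paleyGraph_adj_iff_quadraticChar n h4 x y).1 hadj).2, Int.cast_one]
  · have hne : x - y ≠ 0 := sub_ne_zero.2 hxy
    have h1 : quadraticChar (ZMod (n + 1)) (x - y) ≠ 1 := fun h =>
      hadj ((paleyGraph_adj_iff_quadraticChar n h4 x y).2 ⟨hxy, h⟩)
    rcases quadraticChar_dichotomy hne with h | h
    · exact absurd h h1
    · rw [h]; norm_num

variable {n} in
/-- **Kunisky–Yu, Proposition 4.5**: `Σ_x χ(a − x) = 0`. [cite: KuniskyYu2022, Proposition 4.5] -/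
theorem sum_quadraticChar_sub (h4 : (n + 1) % 4 = 1) (a : ZMod (n + 1)) :
    ∑ x, quadraticChar (ZMod (n + 1)) (a - x) = 0 := by
  have h : ∑ x, quadraticChar (ZMod (n + 1)) ((Equiv.subLeft a) x) =
      ∑ x, quadraticChar (ZMod (n + 1)) x := Equiv.sum_comp (Equiv.subLeft a) _
  simp only [Equiv.subLeft_apply] at h
  rw [h, quadraticChar_sum_zero (ringChar_zmod_ne_two h4)]

variable {n} in
/-- Jacobsthal: `Σ_t χ(t(t + c)) = −1` for `c ≠ 0` (substitute `t ↦ 1 + c/t`; the computation (75)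
of Kunisky–Yu). [cite: KuniskyYu2022, Proposition 4.6 (75)] -/
theorem sum_quadraticChar_mul_add_eq_neg_one (h4 : (n + 1) % 4 = 1) {c : ZMod (n + 1)}
    (hc : c ≠ 0) : ∑ t, quadraticChar (ZMod (n + 1)) (t * (t + c)) = -1 := by
  let e : ZMod (n + 1) ≃ ZMod (n + 1) :=
    { toFun := fun x => 1 + c * x⁻¹
      invFun := fun t => c * (t - 1)⁻¹
      left_inv := fun x => by
        simp only [add_sub_cancel_left, mul_inv, inv_inv, ← mul_assoc, mul_inv_cancel₀ hc, one_mul]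
      right_inv := fun t => by
        simp only [mul_inv, inv_inv, ← mul_assoc, mul_inv_cancel₀ hc, one_mul, add_sub_cancel] }
  have key : ∀ x : ZMod (n + 1),
      quadraticChar (ZMod (n + 1)) (x * (x + c)) =
        quadraticChar (ZMod (n + 1)) (e x) - if x = 0 then 1 else 0 := by
    intro x
    by_cases hx : x = 0
    · simp [hx, e]
    · rw [if_neg hx, sub_zero, show x * (x + c) = x ^ 2 * (1 + c * x⁻¹) by field_simp]
      rw [map_mul, map_pow, quadraticChar_sq_one hx, one_mul]
      rfl
  rw [Finset.sum_congr rfl (fun x _ => key x), Finset.sum_sub_distrib,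
    Equiv.sum_comp e (fun x => quadraticChar (ZMod (n + 1)) x),
    quadraticChar_sum_zero (ringChar_zmod_ne_two h4),
    Finset.sum_ite_eq' Finset.univ (0 : ZMod (n + 1)) (fun _ => (1 : ℤ))]
  simp

variable {n} in
/-- **Kunisky–Yu, Proposition 4.6**: `Σ_x χ(a − x)χ(b − x) = −1 + 𝟙{a = b}·p` (here written with the
diagonal value `p − 1 = n`). [cite: KuniskyYu2022, Proposition 4.6 (73)] -/
theorem sum_quadraticChar_sub_mul_sub (h4 : (n + 1) % 4 = 1) (a b : ZMod (n + 1)) :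
    ∑ x, quadraticChar (ZMod (n + 1)) ((a - x) * (b - x)) = if a = b then (n : ℤ) else -1 := by
  by_cases hab : a = b
  · subst hab
    rw [if_pos rfl]
    have hx : ∀ x : ZMod (n + 1),
        quadraticChar (ZMod (n + 1)) ((a - x) * (a - x)) = if x ≠ a then 1 else 0 := by
      intro x
      by_cases hxa : x = a
      · simp [hxa]
      · rw [if_pos hxa, ← sq, quadraticChar_sq_one' (sub_ne_zero.2 (Ne.symm hxa))]
    rw [Finset.sum_congr rfl (fun x _ => hx x), Finset.sum_boole, Finset.filter_ne',
      card_erase_of_mem (mem_univ _), card_univ, ZMod.card, Nat.add_sub_cancel]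
  · rw [if_neg hab]
    have hc : a - b ≠ 0 := sub_ne_zero.2 hab
    have h := sum_quadraticChar_mul_add_eq_neg_one h4 hc
    rw [← Equiv.sum_comp (Equiv.subRight a)
      (fun t => quadraticChar (ZMod (n + 1)) (t * (t + (a - b))))] at h
    rw [← h]
    refine Finset.sum_congr rfl fun x _ => ?_
    simp only [Equiv.subRight_apply]
    congr 1
    ring

/-- **Kunisky–Yu, Proposition 4.5 for the Seidel matrix**: `S_{G_p}` has zero row sums (`G_p` is
`(p−1)/2`-regular). [cite: KuniskyYu2022, Proposition 4.5] -/
theorem sum_paley_seidel [DecidableRel (paleyGraph (n + 1)).Adj] (h4 : (n + 1) % 4 = 1)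
    {S : Matrix (Fin (n + 1)) (Fin (n + 1)) ℝ}
    (hS : ∀ u v, S u v = if u = v then 0 else if (paleyGraph (n + 1)).Adj u v then 1 else -1)
    (x : ZMod (n + 1)) : ∑ y, S x y = 0 := by
  have h := sum_quadraticChar_sub h4 x
  have h' : ((∑ y, quadraticChar (ZMod (n + 1)) (x - y) : ℤ) : ℝ) = 0 := by rw [h, Int.cast_zero]
  rw [Int.cast_sum] at h'
  simp only [paley_seidel_apply n h4 hS]
  exact h'

/-- Entries of `S_{G_p}²`: `Σ_y χ(x − y)χ(y − z) = p𝟙{x = z} − 1`.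
[cite: KuniskyYu2022, Proposition 4.6 (74)] -/
theorem paley_seidel_mul_self_apply [DecidableRel (paleyGraph (n + 1)).Adj]
    (h4 : (n + 1) % 4 = 1) {S : Matrix (Fin (n + 1)) (Fin (n + 1)) ℝ}
    (hS : ∀ u v, S u v = if u = v then 0 else if (paleyGraph (n + 1)).Adj u v then 1 else -1)
    (x z : ZMod (n + 1)) : (S * S) x z = if x = z then (n : ℝ) else -1 := by
  have hxz : ∀ y : ZMod (n + 1),
      (quadraticChar (ZMod (n + 1)) (x - y) : ℝ) * (quadraticChar (ZMod (n + 1)) (y - z) : ℝ) =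
        (quadraticChar (ZMod (n + 1)) ((x - y) * (z - y)) : ℝ) := by
    intro y
    rw [← quadraticChar_neg_eq h4 (y - z), neg_sub, map_mul, Int.cast_mul]
  have hsum : ((∑ y, quadraticChar (ZMod (n + 1)) ((x - y) * (z - y)) : ℤ) : ℝ) =
      if x = z then (n : ℝ) else -1 := by
    rw [sum_quadraticChar_sub_mul_sub h4 x z]
    split_ifs <;> simp
  rw [Int.cast_sum] at hsum
  rw [mul_apply]
  simp only [paley_seidel_apply n h4 hS, hxz]
  exact hsum

/-- **Kunisky–Yu, Proposition 4.6 (74)**: `S_{G_p}² = pI − J`.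
[cite: KuniskyYu2022, Proposition 4.6 (74)] -/
theorem paley_seidel_mul_self [DecidableRel (paleyGraph (n + 1)).Adj] (h4 : (n + 1) % 4 = 1)
    {S : Matrix (Fin (n + 1)) (Fin (n + 1)) ℝ}
    (hS : ∀ u v, S u v = if u = v then 0 else if (paleyGraph (n + 1)).Adj u v then 1 else -1) :
    S * S = (Fintype.card (Fin (n + 1)) : ℝ) • (1 : Matrix (Fin (n + 1)) (Fin (n + 1)) ℝ) -
        of fun _ _ => 1 := by
  ext x z
  rw [paley_seidel_mul_self_apply n h4 hS x z, Fintype.card_fin, Matrix.sub_apply,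
    Matrix.smul_apply, one_apply, of_apply, smul_eq_mul, mul_ite, mul_one, mul_zero]
  by_cases h : x = z
  · have h' : @Eq (ZMod (n + 1)) x z := h
    rw [if_pos h', if_pos h]; push_cast; ring
  · have h' : ¬ @Eq (ZMod (n + 1)) x z := h
    rw [if_neg h', if_neg h]; ring

/-- **Kunisky–Yu (18), lower half, for the complement**: `√p ≤ las⁽¹⁾(Ḡ_p) = SOS₂(G_p)` for every
prime `p ≡ 1 (mod 4)` — the level-`1` case of the dictionary `SOS_{2t}(G) = las⁽ᵗ⁾(Ḡ)` used to state
`kuniskyYu2022_theorem_1_2`. [cite: KuniskyYu2022, §2.2.2 (18)] -/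
theorem sqrt_le_lasserreStableBound_compl_paleyGraph_one {p : ℕ} (hpr : p.Prime)
    (h4 : p % 4 = 1) : Real.sqrt p ≤ lasserreStableBound (paleyGraph p)ᶜ 1 := by
  classical
  obtain ⟨m, rfl⟩ : ∃ m, p = m + 1 := ⟨p - 1, (Nat.succ_pred_eq_of_pos hpr.pos).symm⟩
  haveI : Fact (m + 1).Prime := ⟨hpr⟩
  set S : Matrix (Fin (m + 1)) (Fin (m + 1)) ℝ :=
    of fun u v => if u = v then 0 else if (paleyGraph (m + 1)).Adj u v then 1 else -1 with hSdef
  have hS : ∀ u v, S u v = if u = v then 0 else if (paleyGraph (m + 1)).Adj u v then 1 else -1 :=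
    fun u v => rfl
  have h := sqrt_card_le_lasserreStableBound_compl_one (paleyGraph (m + 1)) S hS
    (fun x => sum_paley_seidel m h4 hS x) (paley_seidel_mul_self m h4 hS)
  rwa [Fintype.card_fin] at h

/-- **Kunisky–Yu (18), lower half**: `√p ≤ las⁽¹⁾(G_p)` (`= ϑ(G_p) = √p`) for every prime
`p ≡ 1 (mod 4)` — the level `t = 1` rung of the Paley family. [cite: KuniskyYu2022, §2.2.2 (18)] -/
theorem sqrt_le_lasserreStableBound_paleyGraph_one {p : ℕ} (hpr : p.Prime) (h4 : p % 4 = 1) :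
    Real.sqrt p ≤ lasserreStableBound (paleyGraph p) 1 := by
  classical
  obtain ⟨m, rfl⟩ : ∃ m, p = m + 1 := ⟨p - 1, (Nat.succ_pred_eq_of_pos hpr.pos).symm⟩
  haveI : Fact (m + 1).Prime := ⟨hpr⟩
  set S : Matrix (Fin (m + 1)) (Fin (m + 1)) ℝ :=
    of fun u v => if u = v then 0 else if (paleyGraph (m + 1)).Adj u v then 1 else -1 with hSdef
  have hS : ∀ u v, S u v = if u = v then 0 else if (paleyGraph (m + 1)).Adj u v then 1 else -1 :=
    fun u v => rfl
  have h := sqrt_card_le_lasserreStableBound_one (paleyGraph (m + 1)) S hS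
    (fun x => sum_paley_seidel m h4 hS x) (paley_seidel_mul_self m h4 hS)
  rwa [Fintype.card_fin] at h

end Paley

end Literature.Combinatorics.SimpleGraph

end
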